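import Summits.QuantumAdvantage.QuantumAdvantage.Theorems.CubicForrelationNearExactIsExactTwelveLevelFiveRigidFlat

/-!
# Crux `CubicForrelation.NearExactIsExact` (stmt-QuantumAdvantage-14043) — n = 12, open window `(57/64, 29/32)`, a LEVEL-5 side in the RIGID
  case with `4 ∣ e₅` off the odd hyperplane: the period group `R₇` of the 7-flat `L₅` IS THE RADICAL of the alternating form of the sign bit,
  which therefore has exactly `128` elements (rank `4`)

Certificate seat `b2b-cforr-cert` (gen 29).  HONEST FRAMING: kernel-checked finite-slice lemmas (standard axioms; the only case checks are the
tree's `r1_pf_rank2`) about cubic Boolean pairs on 12 bits.  After …TwelveLevelFiveRigidFlat (`L₅ = t ⊕ R₇`, `#R₇ = 128`) this file recovers on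
the WHOLE open window the last structural statement gens 22–23 had at `Φ = 29/32` (…R1RadicalAt2932, `r1_structure`): `R₇ = R := rad B ∩ V`,
where `B(p,q) = hb(x₀) ⊕ hb(x₀⊕p) ⊕ hb(x₀⊕q) ⊕ hb(x₀⊕p⊕q)` is the base-free alternating form of the sign bit `hb = [e₅ ≡ 3 (mod 4)]` along `V`
(`tzl5_hsd`).  So the rigid level-5 side on the window is EXACTLY configuration R1 up to the `≤ 511` units of slack (values of `e₅` on `P`
beyond `{σ, −3σ}`-minimum and a small even residual off `P`).  NO value of `θ₁₂` is claimed; NOT summit progress.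

THE ARGUMENT.  (1) `tzs_section_even`: for `r ∈ R₇` (a period of `L₅` along `P`) every parametrised 4-flat `t ⊕ ⟨r, a₁, a₂, a₃⟩` (`t ∈ P`,
`aᵢ ∈ V`) meets `L₅` in an even number of parameters (the halves `ε₀ = 0 / 1` are interchanged by `⊕ r`).  (2) `tzs_pf_zero`: hence
`Pf(r, v, c', d') = 0` for all `v, c', d' ∈ V` (`tzr_parity`).  (3) `tzs_R7_orth`: if `B(v, r) = 1` for some `v ∈ V`, (2) says
`B(d', c') = B(c', r)B(d', v) ⊕ B(d', r)B(c', v)` on `V × V` — a rank-2 form, whose Pfaffian vanishes on every frame (`r1_pf_rank2`), against the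
Pfaffian frame of `tzr_frame`; so `R₇ ⊥_B V`.  (4) `tzs_radical_eq`: `R₇ ⊆ R` and `16·#R ≤ #V` (`d0_R_bound`, a Pfaffian frame exists) give
`R = R₇`, `#R = 128`.  Packaging: `tzs_window_rigid_radical`.

References: MacWilliams–Sloane (1977) Ch. 15 §2 (symplectic forms over `𝔽₂`, radicals, Pfaffians); C. Carlet (2021) §5.2; Dickson's theorem.
Axioms: the standard three.
-/

set_option linter.dupNamespace false -- D-0017: single-problem summit ⇒ `QuantumAdvantage.QuantumAdvantage` by design

noncomputable section

namespace Summit.QuantumAdvantage.QuantumAdvantage.Theorems.CubicForrelation.NearExactIsExact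

open Finset
open Literature.Computability.QuantumComplexity
open Literature.Computability.QuantumComplexity.BuzetChailloux (bxor zeroVec bxor_bxor_cancel_left bxor_zeroVec zeroVec_bxor bxor_comm
  bxor_self)
open Literature.Computability.QuantumComplexity.DerivativeWalsh (W)

/-! ### Sections through a period are even -/

/-- **Even sections through a period.**  If translation by `r ∈ V` preserves membership in `L₅ = {e₅ ≢ σ₅ (mod 8)}` along the odd hyperplane,
then for every base `t ∈ P` and `a₁, a₂, a₃ ∈ V` the parametrised 4-flat `t ⊕ ⟨r, a₁, a₂, a₃⟩` meets `L₅` in an even number of parameters.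
[this work] -/
theorem tzs_section_even (f : (Fin (6 + 6) → Bool) → Bool) (u' : (Fin (6 + 6) → Bool) → ℤ)
    (V : Finset (Fin (6 + 6) → Bool)) (x₀ : Fin (6 + 6) → Bool) (h0 : zeroVec ∈ V) (hadd : ∀ a ∈ V, ∀ b ∈ V, bxor a b ∈ V)
    (hP : (univ.filter fun x : Fin (6 + 6) → Bool => Odd (u' x)) = V.image (bxor x₀))
    (hb : (Fin (6 + 6) → Bool) → Bool) {r : Fin (6 + 6) → Bool}
    (hper : ∀ x, Odd (u' x) → (¬ (8 : ℤ) ∣ u' (bxor x r) - 2 * sZ (f (bxor x r)) - sZ (hb (bxor x r)) ↔ ¬ (8 : ℤ) ∣ u' x - 2 * sZ (f x) - sZ (hb x)))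
    {t a₁ a₂ a₃ : Fin (6 + 6) → Bool} (ht : Odd (u' t)) (ha₁ : a₁ ∈ V) (ha₂ : a₂ ∈ V) (ha₃ : a₃ ∈ V) :
    Even #(univ.filter fun ε : Fin 4 → Bool => ¬ (8 : ℤ) ∣ u' (fun j => t j ^^ decide (Odd #(univ.filter fun i => ε i && (![r, a₁, a₂, a₃] : Fin 4 → Fin (6 + 6) → Bool) i j))) - 2 * sZ (f (fun j => t j ^^ decide (Odd #(univ.filter fun i => ε i && (![r, a₁, a₂, a₃] : Fin 4 → Fin (6 + 6) → Bool) i j)))) - sZ (hb (fun j => t j ^^ decide (Odd #(univ.filter fun i => ε i && (![r, a₁, a₂, a₃] : Fin 4 → Fin (6 + 6) → Bool) i j))))) := by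
  classical
  have hPV : ∀ x, Odd (u' x) → ∀ a ∈ V, Odd (u' (bxor x a)) := by
    intro x hx a ha
    have h := fl1_coset_vadd hadd hP (mem_filter.2 ⟨mem_univ _, hx⟩) ha
    exact (mem_filter.1 h).2
  have ha' : ∀ i, (![a₁, a₂, a₃] : Fin 3 → Fin (6 + 6) → Bool) i ∈ V := by
    intro i; fin_cases i <;> assumption
  have hin : ∀ ε : Fin 3 → Bool, Odd (u' (fun j => t j ^^ decide (Odd #(univ.filter fun i => ε i && (![a₁, a₂, a₃] : Fin 3 → Fin (6 + 6) → Bool) i j)))) :=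
    fun ε => fr_mem_flatPt3 V h0 (fun z => Odd (u' z)) hPV ht _ ha' ε
  have ea : (![r, a₁, a₂, a₃] : Fin 4 → Fin (6 + 6) → Bool) = Fin.cons r (![a₁, a₂, a₃] : Fin 3 → Fin (6 + 6) → Bool) := rfl
  rw [erm_card_split]
  have hfalse : (univ.filter fun ε : Fin 3 → Bool => ¬ (8 : ℤ) ∣ u' (fun j => t j ^^ decide (Odd #(univ.filter fun i => (Fin.cons false ε : Fin (3 + 1) → Bool) i && (![r, a₁, a₂, a₃] : Fin 4 → Fin (6 + 6) → Bool) i j))) - 2 * sZ (f (fun j => t j ^^ decide (Odd #(univ.filter fun i => (Fin.cons false ε : Fin (3 + 1) → Bool) i && (![r, a₁, a₂, a₃] : Fin 4 → Fin (6 + 6) → Bool) i j)))) - sZ (hb (fun j => t j ^^ decide (Odd #(univ.filter fun i => (Fin.cons false ε : Fin (3 + 1) → Bool) i && (![r, a₁, a₂, a₃] : Fin 4 → Fin (6 + 6) → Bool) i j))))) =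
      univ.filter fun ε : Fin 3 → Bool => ¬ (8 : ℤ) ∣ u' (fun j => t j ^^ decide (Odd #(univ.filter fun i => ε i && (![a₁, a₂, a₃] : Fin 3 → Fin (6 + 6) → Bool) i j))) - 2 * sZ (f (fun j => t j ^^ decide (Odd #(univ.filter fun i => ε i && (![a₁, a₂, a₃] : Fin 3 → Fin (6 + 6) → Bool) i j)))) - sZ (hb (fun j => t j ^^ decide (Odd #(univ.filter fun i => ε i && (![a₁, a₂, a₃] : Fin 3 → Fin (6 + 6) → Bool) i j)))) := by
    refine filter_congr fun ε _ => ?_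
    rw [ea, erm_flatPt_cons]
    simp only [Bool.false_and, Bool.xor_false]
  have htrue : (univ.filter fun ε : Fin 3 → Bool => ¬ (8 : ℤ) ∣ u' (fun j => t j ^^ decide (Odd #(univ.filter fun i => (Fin.cons true ε : Fin (3 + 1) → Bool) i && (![r, a₁, a₂, a₃] : Fin 4 → Fin (6 + 6) → Bool) i j))) - 2 * sZ (f (fun j => t j ^^ decide (Odd #(univ.filter fun i => (Fin.cons true ε : Fin (3 + 1) → Bool) i && (![r, a₁, a₂, a₃] : Fin 4 → Fin (6 + 6) → Bool) i j)))) - sZ (hb (fun j => t j ^^ decide (Odd #(univ.filter fun i => (Fin.cons true ε : Fin (3 + 1) → Bool) i && (![r, a₁, a₂, a₃] : Fin 4 → Fin (6 + 6) → Bool) i j))))) =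
      univ.filter fun ε : Fin 3 → Bool => ¬ (8 : ℤ) ∣ u' (fun j => t j ^^ decide (Odd #(univ.filter fun i => ε i && (![a₁, a₂, a₃] : Fin 3 → Fin (6 + 6) → Bool) i j))) - 2 * sZ (f (fun j => t j ^^ decide (Odd #(univ.filter fun i => ε i && (![a₁, a₂, a₃] : Fin 3 → Fin (6 + 6) → Bool) i j)))) - sZ (hb (fun j => t j ^^ decide (Odd #(univ.filter fun i => ε i && (![a₁, a₂, a₃] : Fin 3 → Fin (6 + 6) → Bool) i j)))) := by
    refine filter_congr fun ε _ => ?_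
    rw [ea, erm_flatPt_cons]
    simp only [Bool.true_and]
    have e : (fun j => (t j ^^ decide (Odd #(univ.filter fun i => ε i && (![a₁, a₂, a₃] : Fin 3 → Fin (6 + 6) → Bool) i j))) ^^ r j) =
        bxor (fun j => t j ^^ decide (Odd #(univ.filter fun i => ε i && (![a₁, a₂, a₃] : Fin 3 → Fin (6 + 6) → Bool) i j))) r := by
      funext j; simp only [bxor]
    rw [e]
    exact hper _ (hin ε)
  rw [hfalse, htrue]
  exact ⟨_, rfl⟩

/-! ### The Pfaffian vanishes on frames through a period; periods are `B`-orthogonal to `V` -/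

/-- **`Pf(r, v, c', d') = 0` for a period `r`.**  Rigid bookkeeping of …TwelveLevelFiveRigid plus a period `r ∈ V` of `L₅` along `P` and a point
of `P`: the Pfaffian of every frame `(r, v, c', d')`, `v, c', d' ∈ V`, vanishes (`tzr_parity` and `tzs_section_even`). [this work] -/
theorem tzs_pf_zero (f g : (Fin (6 + 6) → Bool) → Bool) (hf : IsDegLeFun 3 f) (hg : IsDegLeFun 3 g)
    (u' : (Fin (6 + 6) → Bool) → ℤ) (hu' : ∀ x, W (fun y => signOf (g y)) x = (2 : ℝ) ^ 5 * (u' x : ℝ))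
    (V : Finset (Fin (6 + 6) → Bool)) (x₀ : Fin (6 + 6) → Bool) (h0 : zeroVec ∈ V) (hadd : ∀ a ∈ V, ∀ b ∈ V, bxor a b ∈ V)
    (hcardV : #V = 2048) (hP : (univ.filter fun x : Fin (6 + 6) → Bool => Odd (u' x)) = V.image (bxor x₀))
    (h4off : ∀ y, ¬ Odd (u' y) → (4 : ℤ) ∣ u' y - 2 * sZ (f y))
    (hoff : ∑ y ∈ univ.filter (fun y : Fin (6 + 6) → Bool => ¬ Odd (u' y)), (u' y - 2 * sZ (f y)) ^ 2 ≤ 2047)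
    (hb : (Fin (6 + 6) → Bool) → Bool) (hhb : ∀ z, hb z = decide ((u' z - 2 * sZ (f z)) % 4 = 3))
    {r : Fin (6 + 6) → Bool} (hr : r ∈ V) (hper : ∀ x, Odd (u' x) → (¬ (8 : ℤ) ∣ u' (bxor x r) - 2 * sZ (f (bxor x r)) - sZ (hb (bxor x r)) ↔ ¬ (8 : ℤ) ∣ u' x - 2 * sZ (f x) - sZ (hb x)))
    {v c' d' : Fin (6 + 6) → Bool} (hv : v ∈ V) (hc' : c' ∈ V) (hd' : d' ∈ V) :
    ((((hb x₀ ^^ hb (bxor x₀ v) ^^ hb (bxor x₀ r) ^^ hb (bxor (bxor x₀ v) r)) && (hb x₀ ^^ hb (bxor x₀ d') ^^ hb (bxor x₀ c') ^^ hb (bxor (bxor x₀ d') c'))) ^^ ((hb x₀ ^^ hb (bxor x₀ c') ^^ hb (bxor x₀ r) ^^ hb (bxor (bxor x₀ c') r)) && (hb x₀ ^^ hb (bxor x₀ d') ^^ hb (bxor x₀ v) ^^ hb (bxor (bxor x₀ d') v))) ^^ ((hb x₀ ^^ hb (bxor x₀ d') ^^ hb (bxor x₀ r) ^^ hb (bxor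 (bxor x₀ d') r)) && (hb x₀ ^^ hb (bxor x₀ c') ^^ hb (bxor x₀ v) ^^ hb (bxor (bxor x₀ c') v))))) = false := by
  have hx₀ : Odd (u' x₀) := by
    have : x₀ ∈ V.image (bxor x₀) := mem_image.2 ⟨zeroVec, h0, bxor_zeroVec x₀⟩
    rw [← hP] at this; exact (mem_filter.1 this).2
  exact (tzr_parity f g hf hg u' hu' V x₀ h0 hadd hcardV hP h4off hoff hb hhb hx₀ hr hv hc' hd').1 (tzs_section_even f u' V x₀ h0 hadd hP hb hper hx₀ hv hc' hd')

/-- `B` is symmetric in its two arguments (it is the second difference of `hb` at `x₀`). [folklore] -/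
theorem tzs_B_symm (hb : (Fin (6 + 6) → Bool) → Bool) (x₀ p q : Fin (6 + 6) → Bool) :
    (hb x₀ ^^ hb (bxor x₀ p) ^^ hb (bxor x₀ q) ^^ hb (bxor (bxor x₀ p) q)) = (hb x₀ ^^ hb (bxor x₀ q) ^^ hb (bxor x₀ p) ^^ hb (bxor (bxor x₀ q) p)) := by
  have e : bxor (bxor x₀ p) q = bxor (bxor x₀ q) p := by rw [iw_bxor_assoc, iw_bxor_assoc, bxor_comm p q]
  rw [e]
  cases hb x₀ <;> cases hb (bxor x₀ p) <;> cases hb (bxor x₀ q) <;> cases hb (bxor (bxor x₀ q) p) <;> rfl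

/-- **Periods are `B`-orthogonal to `V`.**  Rigid bookkeeping on the window budget (`Σ_P (e₅² − 1) ≤ 1535`, `L₅ ≠ ∅`) and a period `r ∈ V` of
`L₅` along `P`: `B(v, r) = 0` for every `v ∈ V`.  Otherwise `tzs_pf_zero` makes `B` the rank-2 form `B(·,r) ∧ B(·,v)` on `V`, whose Pfaffian
vanishes on every frame (`r1_pf_rank2`) — against the Pfaffian frame of `tzr_frame`. [this work] -/
theorem tzs_R7_orth (f g : (Fin (6 + 6) → Bool) → Bool) (hf : IsDegLeFun 3 f) (hg : IsDegLeFun 3 g)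
    (u' : (Fin (6 + 6) → Bool) → ℤ) (hu' : ∀ x, W (fun y => signOf (g y)) x = (2 : ℝ) ^ 5 * (u' x : ℝ))
    (V : Finset (Fin (6 + 6) → Bool)) (x₀ : Fin (6 + 6) → Bool) (h0 : zeroVec ∈ V) (hadd : ∀ a ∈ V, ∀ b ∈ V, bxor a b ∈ V)
    (hcardV : #V = 2048) (hP : (univ.filter fun x : Fin (6 + 6) → Bool => Odd (u' x)) = V.image (bxor x₀))
    (h4off : ∀ y, ¬ Odd (u' y) → (4 : ℤ) ∣ u' y - 2 * sZ (f y))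
    (hoff : ∑ y ∈ univ.filter (fun y : Fin (6 + 6) → Bool => ¬ Odd (u' y)), (u' y - 2 * sZ (f y)) ^ 2 ≤ 2047)
    (hb : (Fin (6 + 6) → Bool) → Bool) (hhb : ∀ z, hb z = decide ((u' z - 2 * sZ (f z)) % 4 = 3))
    (hbud : ∑ x ∈ univ.filter (fun x : Fin (6 + 6) → Bool => Odd (u' x)), ((u' x - 2 * sZ (f x)) ^ 2 - 1) ≤ 1535)
    (hL : ∃ x, Odd (u' x) ∧ ¬ (8 : ℤ) ∣ u' x - 2 * sZ (f x) - sZ (hb x))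
    {r : Fin (6 + 6) → Bool} (hr : r ∈ V) (hper : ∀ x, Odd (u' x) → (¬ (8 : ℤ) ∣ u' (bxor x r) - 2 * sZ (f (bxor x r)) - sZ (hb (bxor x r)) ↔ ¬ (8 : ℤ) ∣ u' x - 2 * sZ (f x) - sZ (hb x)))
    {v : Fin (6 + 6) → Bool} (hv : v ∈ V) :
    (hb x₀ ^^ hb (bxor x₀ v) ^^ hb (bxor x₀ r) ^^ hb (bxor (bxor x₀ v) r)) = false := by
  rcases Bool.eq_false_or_eq_true (hb x₀ ^^ hb (bxor x₀ v) ^^ hb (bxor x₀ r) ^^ hb (bxor (bxor x₀ v) r)) with hBvr | hBvr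
  swap
  · exact hBvr
  exfalso
  -- `B` is rank 2 on `V`
  have hrank : ∀ c' ∈ V, ∀ d' ∈ V, (hb x₀ ^^ hb (bxor x₀ d') ^^ hb (bxor x₀ c') ^^ hb (bxor (bxor x₀ d') c')) = (((hb x₀ ^^ hb (bxor x₀ c') ^^ hb (bxor x₀ r) ^^ hb (bxor (bxor x₀ c') r)) && (hb x₀ ^^ hb (bxor x₀ d') ^^ hb (bxor x₀ v) ^^ hb (bxor (bxor x₀ d') v))) ^^ ((hb x₀ ^^ hb (bxor x₀ d') ^^ hb (bxor x₀ r) ^^ hb (bxor (bxor x₀ d') r)) && (hb x₀ ^^ hb (bxor x₀ c') ^^ hb (bxor x₀ v) ^^ hb (bxor (bxor x₀ c') v)))) := by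
    intro c' hc' d' hd'
    have h := tzs_pf_zero f g hf hg u' hu' V x₀ h0 hadd hcardV hP h4off hoff hb hhb hr hper hv hc' hd'
    rw [hBvr, Bool.true_and] at h
    revert h
    cases (hb x₀ ^^ hb (bxor x₀ d') ^^ hb (bxor x₀ c') ^^ hb (bxor (bxor x₀ d') c')) <;> cases (hb x₀ ^^ hb (bxor x₀ c') ^^ hb (bxor x₀ r) ^^ hb (bxor (bxor x₀ c') r)) <;> cases (hb x₀ ^^ hb (bxor x₀ d') ^^ hb (bxor x₀ v) ^^ hb (bxor (bxor x₀ d') v)) <;> cases (hb x₀ ^^ hb (bxor x₀ d') ^^ hb (bxor x₀ r) ^^ hb (bxor (bxor x₀ d') r)) <;> cases (hb x₀ ^^ hb (bxor x₀ c') ^^ hb (bxor x₀ v) ^^ hb (bxor (bxor x₀ c') v)) <;> decide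
  -- the Pfaffian frame
  obtain ⟨a₀, ha₀, a₁, ha₁, a₂, ha₂, a₃, ha₃, hPf⟩ := tzr_frame f g hf hg u' hu' V x₀ h0 hadd hcardV hP h4off hoff hb hhb hbud hL
  rw [hrank a₀ ha₀ a₁ ha₁, hrank a₂ ha₂ a₃ ha₃, hrank a₀ ha₀ a₂ ha₂, hrank a₁ ha₁ a₃ ha₃, hrank a₀ ha₀ a₃ ha₃, hrank a₁ ha₁ a₂ ha₂,
    r1_pf_rank2] at hPf
  exact Bool.false_ne_true hPf

/-! ### The radical is `R₇` -/

/-- **The radical of `B` in `V` is the period group `R₇` of `L₅`; it has `128` elements.**  Rigid bookkeeping on the window budget, `R₇ ⊆ V`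
with `#R₇ = 128` all of whose elements are periods of `L₅` along `P` (the output of `tzq_L5_flat`).  Then
`{r ∈ V : B(r, v) = 0 ∀ v ∈ V} = R₇` (`tzs_R7_orth` gives `⊇`; `d0_R_bound` with the Pfaffian frame of `tzr_frame` gives `16·#R ≤ #V`). [this work] -/
theorem tzs_radical_eq (f g : (Fin (6 + 6) → Bool) → Bool) (hf : IsDegLeFun 3 f) (hg : IsDegLeFun 3 g)
    (u' : (Fin (6 + 6) → Bool) → ℤ) (hu' : ∀ x, W (fun y => signOf (g y)) x = (2 : ℝ) ^ 5 * (u' x : ℝ))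
    (V : Finset (Fin (6 + 6) → Bool)) (x₀ : Fin (6 + 6) → Bool) (h0 : zeroVec ∈ V) (hadd : ∀ a ∈ V, ∀ b ∈ V, bxor a b ∈ V)
    (hcardV : #V = 2048) (hP : (univ.filter fun x : Fin (6 + 6) → Bool => Odd (u' x)) = V.image (bxor x₀))
    (h4off : ∀ y, ¬ Odd (u' y) → (4 : ℤ) ∣ u' y - 2 * sZ (f y))
    (hoff : ∑ y ∈ univ.filter (fun y : Fin (6 + 6) → Bool => ¬ Odd (u' y)), (u' y - 2 * sZ (f y)) ^ 2 ≤ 2047)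
    (hb : (Fin (6 + 6) → Bool) → Bool) (hhb : ∀ z, hb z = decide ((u' z - 2 * sZ (f z)) % 4 = 3))
    (hbud : ∑ x ∈ univ.filter (fun x : Fin (6 + 6) → Bool => Odd (u' x)), ((u' x - 2 * sZ (f x)) ^ 2 - 1) ≤ 1535)
    (hL : ∃ x, Odd (u' x) ∧ ¬ (8 : ℤ) ∣ u' x - 2 * sZ (f x) - sZ (hb x))
    (R₇ : Finset (Fin (6 + 6) → Bool)) (hR7V : R₇ ⊆ V) (hR7card : #R₇ = 128)
    (hper : ∀ r ∈ R₇, ∀ x, Odd (u' x) → (¬ (8 : ℤ) ∣ u' (bxor x r) - 2 * sZ (f (bxor x r)) - sZ (hb (bxor x r)) ↔ ¬ (8 : ℤ) ∣ u' x - 2 * sZ (f x) - sZ (hb x))) :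
    (V.filter fun r => ∀ v ∈ V, (hb x₀ ^^ hb (bxor x₀ r) ^^ hb (bxor x₀ v) ^^ hb (bxor (bxor x₀ r) v)) = false) = R₇ ∧ #(V.filter fun r => ∀ v ∈ V, (hb x₀ ^^ hb (bxor x₀ r) ^^ hb (bxor x₀ v) ^^ hb (bxor (bxor x₀ r) v)) = false) = 128 := by
  classical
  have hbe : ∀ z, hb z = decide ((u' z - 2 * sZ (f z)) % 4 = 3) := hhb
  -- `R₇ ⊆ R`
  have hsub : R₇ ⊆ (V.filter fun r => ∀ v ∈ V, (hb x₀ ^^ hb (bxor x₀ r) ^^ hb (bxor x₀ v) ^^ hb (bxor (bxor x₀ r) v)) = false) := by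
    intro r hr
    refine mem_filter.2 ⟨hR7V hr, fun v hv => ?_⟩
    rw [tzs_B_symm hb x₀ r v]
    exact tzs_R7_orth f g hf hg u' hu' V x₀ h0 hadd hcardV hP h4off hoff hb hhb hbud hL (hR7V hr) (hper r hr) hv
  -- `16·#R ≤ #V` via `d0_R_bound` (coset written as the even set of `u' + 1`)
  set u'' : (Fin (6 + 6) → Bool) → ℤ := fun x => u' x + 1 with hu''
  have hfilt : (univ.filter fun x : Fin (6 + 6) → Bool => ¬ Odd (u'' x)) = univ.filter fun x : Fin (6 + 6) → Bool => Odd (u' x) := by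
    refine filter_congr fun x _ => ?_
    simp only [u'', Int.not_odd_iff_even, Int.even_add_one, Int.not_even_iff_odd]
  have hS'' : (univ.filter fun x : Fin (6 + 6) → Bool => ¬ Odd (u'' x)) = V.image (bxor x₀) := by rw [hfilt, hP]
  have hsd := tzl5_hsd f g hf hg u' hu' V x₀ h0 hadd hcardV hP h4off
  have hsd'' : ∀ x, x ∈ (univ.filter fun x : Fin (6 + 6) → Bool => ¬ Odd (u'' x)) → ∀ p ∈ V, ∀ q ∈ V, hb (bxor (bxor x p) q) =
      (hb x ^^ hb (bxor x p) ^^ hb (bxor x q) ^^ (hb x₀ ^^ hb (bxor x₀ p) ^^ hb (bxor x₀ q) ^^ hb (bxor (bxor x₀ p) q))) := by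
    intro x hx p hp q hq
    rw [hfilt] at hx
    simp only [hbe]
    exact hsd x (mem_filter.1 hx).2 p hp q hq
  obtain ⟨a₀, ha₀, a₁, ha₁, a₂, ha₂, a₃, ha₃, hPf⟩ := tzr_frame f g hf hg u' hu' V x₀ h0 hadd hcardV hP h4off hoff hb hhb hbud hL
  have hbound := d0_R_bound V u'' x₀ h0 hadd hS'' hb hsd'' ha₀ ha₁ ha₂ ha₃ hPf
  rw [hcardV] at hbound
  have hle : #(V.filter fun r => ∀ v ∈ V, (hb x₀ ^^ hb (bxor x₀ r) ^^ hb (bxor x₀ v) ^^ hb (bxor (bxor x₀ r) v)) = false) ≤ 128 := by omega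
  have heq : (V.filter fun r => ∀ v ∈ V, (hb x₀ ^^ hb (bxor x₀ r) ^^ hb (bxor x₀ v) ^^ hb (bxor (bxor x₀ r) v)) = false) = R₇ := (eq_of_subset_of_card_le hsub (by rw [hR7card]; exact hle)).symm
  exact ⟨heq, by rw [heq, hR7card]⟩

/-! ### Packaging on the open window -/

/-- **The rigid level-5 side on the open window is configuration R1 (packaging).**  Cubic `f, g` on 12 bits, `W_g = 32u'` with some `u'` odd,
`57/64 < Φ(f,g)`, `4 ∣ e₅` off the odd set, some point of the odd set with `e₅ ≢ σ₅ (mod 8)`.  Then: the odd set is `x₀ ⊕ V` (`#V = 2048`);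
the radical `R = {r ∈ V : B(r,·) ≡ 0 on V}` of the alternating form of the sign bit has exactly `128` elements; `L₅ = t ⊕ R` for every `t ∈ L₅`
(`#L₅ = 128`); `Σ_P (e₅² − 1) ≥ 1024`, off-hyperplane energy `≤ 511`, total slack `≤ 1535`.  Finite-slice statement, NOT summit progress.
[this work] -/
theorem tzs_window_rigid_radical (f g : (Fin (6 + 6) → Bool) → Bool) (hf : IsDegLeFun 3 f) (hg : IsDegLeFun 3 g)
    (u' : (Fin (6 + 6) → Bool) → ℤ) (hu' : ∀ x, W (fun y => signOf (g y)) x = (2 : ℝ) ^ 5 * (u' x : ℝ)) (hodd : ∃ x, Odd (u' x))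
    (hlo : (57 / 64 : ℝ) < forrelation f g)
    (h4off : ∀ y, ¬ Odd (u' y) → (4 : ℤ) ∣ u' y - 2 * sZ (f y))
    (hb : (Fin (6 + 6) → Bool) → Bool) (hhb : ∀ z, hb z = decide ((u' z - 2 * sZ (f z)) % 4 = 3))
    (hL : ∃ x, Odd (u' x) ∧ ¬ (8 : ℤ) ∣ u' x - 2 * sZ (f x) - sZ (hb x)) :
    ∃ (V : Finset (Fin (6 + 6) → Bool)) (x₀ : Fin (6 + 6) → Bool),
      zeroVec ∈ V ∧ (∀ a ∈ V, ∀ b ∈ V, bxor a b ∈ V) ∧ #V = 2048 ∧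
      (univ.filter fun x : Fin (6 + 6) → Bool => Odd (u' x)) = V.image (bxor x₀) ∧
      #(V.filter fun r => ∀ v ∈ V, (hb x₀ ^^ hb (bxor x₀ r) ^^ hb (bxor x₀ v) ^^ hb (bxor (bxor x₀ r) v)) = false) = 128 ∧
      #(univ.filter fun z : Fin (6 + 6) → Bool => Odd (u' z) ∧ ¬ (8 : ℤ) ∣ u' z - 2 * sZ (f z) - sZ (hb z)) = 128 ∧
      (∀ t, Odd (u' t) → ¬ (8 : ℤ) ∣ u' t - 2 * sZ (f t) - sZ (hb t) →
        (univ.filter fun z : Fin (6 + 6) → Bool => Odd (u' z) ∧ ¬ (8 : ℤ) ∣ u' z - 2 * sZ (f z) - sZ (hb z)) = (V.filter fun r => ∀ v ∈ V, (hb x₀ ^^ hb (bxor x₀ r) ^^ hb (bxor x₀ v) ^^ hb (bxor (bxor x₀ r) v)) = false).image (bxor t)) ∧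
      1024 ≤ ∑ x ∈ univ.filter (fun x : Fin (6 + 6) → Bool => Odd (u' x)), ((u' x - 2 * sZ (f x)) ^ 2 - 1) ∧
      ∑ y ∈ univ.filter (fun y : Fin (6 + 6) → Bool => ¬ Odd (u' y)), (u' y - 2 * sZ (f y)) ^ 2 ≤ 511 ∧
      ∑ x ∈ univ.filter (fun x : Fin (6 + 6) → Bool => Odd (u' x)), ((u' x - 2 * sZ (f x)) ^ 2 - 1) +
        ∑ y ∈ univ.filter (fun y : Fin (6 + 6) → Bool => ¬ Odd (u' y)), (u' y - 2 * sZ (f y)) ^ 2 ≤ 1535 := by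
  classical
  obtain ⟨V, x₀, h0, hadd, hcardV, hP, -, -, -, h1024, h511, htot⟩ :=
    tzr_window_rigid f g hf hg u' hu' hodd hlo h4off hb hhb hL
  have hPnn : (0 : ℤ) ≤ ∑ y ∈ univ.filter (fun y : Fin (6 + 6) → Bool => ¬ Odd (u' y)), (u' y - 2 * sZ (f y)) ^ 2 :=
    sum_nonneg fun _ _ => sq_nonneg _
  have hbud : ∑ x ∈ univ.filter (fun x : Fin (6 + 6) → Bool => Odd (u' x)), ((u' x - 2 * sZ (f x)) ^ 2 - 1) ≤ 1535 := by linarith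
  have hoff : ∑ y ∈ univ.filter (fun y : Fin (6 + 6) → Bool => ¬ Odd (u' y)), (u' y - 2 * sZ (f y)) ^ 2 ≤ 2047 := by linarith
  obtain ⟨h128, R₇, hsub, -, -, hRcard, hper, hstr⟩ := tzq_L5_flat f g hf hg u' hu' V x₀ h0 hadd hcardV hP h4off hoff hb hhb hbud hL
  obtain ⟨hReq, hRcard'⟩ := tzs_radical_eq f g hf hg u' hu' V x₀ h0 hadd hcardV hP h4off hoff hb hhb hbud hL R₇ hsub hRcard hper
  refine ⟨V, x₀, h0, hadd, hcardV, hP, hRcard', h128, fun t ht htL => ?_, h1024, h511, htot⟩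
  rw [hReq]; exact hstr t ht htL

end Summit.QuantumAdvantage.QuantumAdvantage.Theorems.CubicForrelation.NearExactIsExact

end
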